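import Summits.Ventures.PercRepro.Graph
import Summits.Ventures.PercRepro.SwapBijection

/-!
# Clusters are determined by their incident edges; the edge sets of GZ24 Theorem 4.6

With `A = C_a(ω)`, `B = C_b(ω)`, `C = C_c(ω)` the open clusters of three marks in a
configuration `ω` and `G.edgesAt X` the edges incident to a vertex set `X`:

* `cluster_eq_of_agree`: a cluster is determined by the states of the edges incident to it
  (`conn_of_open_edges` is the one-sided version: open paths survive when the `ω`-open edges at
  the cluster stay open);
* `swapSetBC ω a b c = edgesAt (B ∪ C) \ edgesAt A` (Gladkov–Zimin's `S₃`, arXiv:2404.08873,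
  proof of Theorem 4.6) and `swapSetC ω a b c = edgesAt C ∪ (edgesAt B \ edgesAt A)` (their
  `S₁`; `S₂ = swapSetC ω a c b`);
* both are **recoverable** from the swapped pair (`recoverable_swapSetBC`,
  `recoverable_swapSetC`, the `Recoverable` predicate of `SwapBijection.lean`): the three
  clusters of `ω` are read off hybrids of the two swapped configurations (`hybridBC`,
  `hybridC`), which is the static content of the paper's decision trees.

The inequality itself is in `Summits.Ventures.PercRepro.GZ24Final`.
-/

namespace PercRepro

open Finset

namespace MultiGraph

variable {V E : Type*} (G : MultiGraph V E)

/-! ### Edges incident to a vertex set; clusters are determined by their incident edges -/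

/-- The edges with at least one endpoint in the vertex set `X`. -/
def edgesAt (X : Set V) : Set E := {e | G.fst e ∈ X ∨ G.snd e ∈ X}

/-- Membership in `edgesAt`. -/
theorem mem_edgesAt {X : Set V} {e : E} : e ∈ G.edgesAt X ↔ G.fst e ∈ X ∨ G.snd e ∈ X := Iff.rfl

/-- `edgesAt` is monotone. -/
theorem edgesAt_mono {X Y : Set V} (h : X ⊆ Y) : G.edgesAt X ⊆ G.edgesAt Y := by
  intro e he
  rcases he with h1 | h1
  · exact Or.inl (h h1)
  · exact Or.inr (h h1)

/-- An edge open in `ω` with an endpoint in the cluster of `v` has both endpoints in it. -/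
theorem snd_mem_cluster_of_open {ω : Config E} {v : V} {e : E} (he : ω e = true)
    (h : G.fst e ∈ G.cluster ω v) : G.snd e ∈ G.cluster ω v :=
  (h : G.Conn ω v (G.fst e)).tail (G.openAdj_of_open e he)

/-- An edge open in `ω` with an endpoint in the cluster of `v` has both endpoints in it. -/
theorem fst_mem_cluster_of_open {ω : Config E} {v : V} {e : E} (he : ω e = true)
    (h : G.snd e ∈ G.cluster ω v) : G.fst e ∈ G.cluster ω v :=
  (h : G.Conn ω v (G.snd e)).tail (G.openAdj_of_open e he).symm

variable {G}

/-- Open paths from `v` in `ω` survive in `ψ` as soon as `ψ` keeps open every `ω`-open edge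
incident to the cluster of `v`. -/
theorem conn_of_open_edges {ω ψ : Config E} {v : V}
    (h : ∀ e, ω e = true → e ∈ G.edgesAt (G.cluster ω v) → ψ e = true) {u : V}
    (huv : G.Conn ω v u) : G.Conn ψ v u := by
  refine Conn.induction (motive := fun x => G.Conn ψ v x) (Conn.refl G ψ v) ?_ huv
  intro x y hvx hxy hψ
  obtain ⟨e, he, hend⟩ := hxy
  have hmem : e ∈ G.edgesAt (G.cluster ω v) := by
    rcases hend with ⟨h1, _⟩ | ⟨_, h2⟩
    · exact Or.inl (h1 ▸ hvx)
    · exact Or.inr (h2 ▸ hvx)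
  exact hψ.tail ⟨e, h e he hmem, hend⟩

/-- A cluster is determined by the states of the edges incident to it: if `ψ` agrees with `ω` on
every edge incident to `C_v(ω)`, then `C_v(ψ) = C_v(ω)`. -/
theorem cluster_eq_of_agree {ω ψ : Config E} {v : V}
    (h : ∀ e ∈ G.edgesAt (G.cluster ω v), ω e = ψ e) : G.cluster ψ v = G.cluster ω v := by
  ext u
  constructor
  · intro hu
    refine mem_of_conn_of_closed_boundary (ω := ψ) (X := G.cluster ω v) ?_
      (G.self_mem_cluster ω v) hu
    intro e he
    constructor
    · intro hf
      have hωe : ω e = true := (h e (Or.inl hf)).trans he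
      exact G.snd_mem_cluster_of_open hωe hf
    · intro hs
      have hωe : ω e = true := (h e (Or.inr hs)).trans he
      exact G.fst_mem_cluster_of_open hωe hs
  · intro hu
    exact conn_of_open_edges (fun e he hmem => (h e hmem) ▸ he) hu

/-- Agreement on the edges at the clusters of several marks gives all those clusters. -/
theorem cluster_eq_of_agree_of_subset {ω ψ : Config E} {v : V} {X : Set V}
    (hX : G.cluster ω v ⊆ X) (h : ∀ e ∈ G.edgesAt X, ω e = ψ e) :
    G.cluster ψ v = G.cluster ω v :=
  cluster_eq_of_agree fun e he => h e (G.edgesAt_mono hX he)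

/-- Disjoint clusters of separated marks. -/
theorem not_mem_cluster_of_mem_cluster_of_sep {ω : Config E} {u v w : V}
    (huv : ¬ G.Conn ω u v) (hw : w ∈ G.cluster ω u) : w ∉ G.cluster ω v :=
  fun hw' => huv ((hw : G.Conn ω u w).trans (hw' : G.Conn ω v w).symm)

/-- `edgesAt` of a union. -/
theorem mem_edgesAt_union_iff {X Y : Set V} {e : E} :
    e ∈ G.edgesAt (X ∪ Y) ↔ e ∈ G.edgesAt X ∨ e ∈ G.edgesAt Y := by
  simp only [mem_edgesAt, Set.mem_union]
  tauto

/-! ### The edge sets of GZ24 Theorem 4.6 and their recoverability -/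

section SwapSets

variable (G)

/-- The paper's `S₃`: the edges at the clusters of `b` and `c` that are not at the cluster of `a`. -/
def swapSetBC (ω : Config E) (a b c : V) : Set E :=
  G.edgesAt (G.cluster ω b ∪ G.cluster ω c) \ G.edgesAt (G.cluster ω a)

/-- The paper's `S₁`: the edges at the cluster of `c`, and the edges at the cluster of `b` that
are not at the cluster of `a`.  (`S₂` is `swapSetC ω a c b`.) -/
def swapSetC (ω : Config E) (a b c : V) : Set E :=
  G.edgesAt (G.cluster ω c) ∪ (G.edgesAt (G.cluster ω b) \ G.edgesAt (G.cluster ω a))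

/-- `S₃` is symmetric in `b`, `c`. -/
theorem swapSetBC_comm (ω : Config E) (a b c : V) :
    G.swapSetBC ω a c b = G.swapSetBC ω a b c := by
  simp only [swapSetBC, Set.union_comm]

/-- Membership in `S₃`. -/
theorem mem_swapSetBC {ω : Config E} {a b c : V} {e : E} :
    e ∈ G.swapSetBC ω a b c ↔
      (e ∈ G.edgesAt (G.cluster ω b) ∨ e ∈ G.edgesAt (G.cluster ω c)) ∧
        e ∉ G.edgesAt (G.cluster ω a) := by
  simp only [swapSetBC, Set.mem_sdiff, mem_edgesAt_union_iff]

/-- Membership in `S₁`. -/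
theorem mem_swapSetC {ω : Config E} {a b c : V} {e : E} :
    e ∈ G.swapSetC ω a b c ↔
      e ∈ G.edgesAt (G.cluster ω c) ∨
        (e ∈ G.edgesAt (G.cluster ω b) ∧ e ∉ G.edgesAt (G.cluster ω a)) := by
  simp only [swapSetC, Set.mem_union, Set.mem_sdiff]

/-- The hybrid recovering the clusters from the pair swapped along `S₃`: the first swapped
configuration on the edges at its `a`-cluster, the second elsewhere. -/
noncomputable def hybridBC (a : V) (φ₁ φ₂ : Config E) : Config E :=
  mix (G.edgesAt (G.cluster φ₁ a)) φ₁ φ₂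

/-- The hybrid recovering the clusters from the pair swapped along `S₁`: the second swapped
configuration on the edges at its `c`-cluster, then the first on the edges at the `a`-cluster
recovered from it, the second elsewhere. -/
noncomputable def hybridC (a c : V) (φ₁ φ₂ : Config E) : Config E :=
  mix (G.edgesAt (G.cluster φ₂ c)) φ₂
    (mix (G.edgesAt (G.cluster (mix (G.edgesAt (G.cluster φ₂ c)) φ₂ φ₁) a)) φ₁ φ₂)

variable {G}

/-- The `a`-cluster survives the swap along `S₃` in the first swapped configuration. -/
theorem cluster_mix_compl_swapSetBC (ω ω' : Config E) (a b c : V) :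
    G.cluster (mix (G.swapSetBC ω a b c)ᶜ ω ω') a = G.cluster ω a := by
  apply cluster_eq_of_agree
  intro e he
  rw [mix_compl_apply_of_notMem]
  intro hmem
  exact (G.mem_swapSetBC.mp hmem).2 he

/-- The hybrid of the pair swapped along `S₃` agrees with `ω` on every edge at the clusters of
`a`, `b`, `c`. -/
theorem hybridBC_agree (ω ω' : Config E) (a b c : V) :
    ∀ e ∈ G.edgesAt (G.cluster ω a ∪ G.cluster ω b ∪ G.cluster ω c),
      ω e = G.hybridBC a (mix (G.swapSetBC ω a b c)ᶜ ω ω') (mix (G.swapSetBC ω a b c) ω ω') e := by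
  intro e he
  simp only [hybridBC]
  rw [cluster_mix_compl_swapSetBC]
  by_cases hA : e ∈ G.edgesAt (G.cluster ω a)
  · rw [mix_apply_of_mem hA, mix_compl_apply_of_notMem]
    intro hmem
    exact (G.mem_swapSetBC.mp hmem).2 hA
  · rw [mix_apply_of_notMem hA, mix_apply_of_mem]
    rw [mem_edgesAt_union_iff, mem_edgesAt_union_iff] at he
    refine G.mem_swapSetBC.mpr ⟨?_, hA⟩
    rcases he with (h | h) | h
    · exact absurd h hA
    · exact Or.inl h
    · exact Or.inr h

/-- `S₃` is recoverable from the swapped pair. -/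
theorem recoverable_swapSetBC (a b c : V) : Recoverable (fun ω _ => G.swapSetBC ω a b c) := by
  refine ⟨fun φ₁ φ₂ => G.swapSetBC (G.hybridBC a φ₁ φ₂) a b c, fun ω ω' => ?_⟩
  have h := hybridBC_agree (G := G) ω ω' a b c
  have ha := cluster_eq_of_agree_of_subset (Set.subset_union_left.trans Set.subset_union_left) h
  have hb := cluster_eq_of_agree_of_subset (Set.subset_union_right.trans Set.subset_union_left) h
  have hc := cluster_eq_of_agree_of_subset Set.subset_union_right h
  show G.swapSetBC (G.hybridBC a (mix (G.swapSetBC ω a b c)ᶜ ω ω') (mix (G.swapSetBC ω a b c) ω ω'))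
      a b c = G.swapSetBC ω a b c
  generalize G.hybridBC a (mix (G.swapSetBC ω a b c)ᶜ ω ω') (mix (G.swapSetBC ω a b c) ω ω') = H
    at ha hb hc ⊢
  simp only [swapSetBC, ha, hb, hc]

/-- The `c`-cluster survives the swap along `S₁` in the second swapped configuration. -/
theorem cluster_mix_swapSetC (ω ω' : Config E) (a b c : V) :
    G.cluster (mix (G.swapSetC ω a b c) ω ω') c = G.cluster ω c := by
  apply cluster_eq_of_agree
  intro e he
  rw [mix_apply_of_mem (G.mem_swapSetC.mpr (Or.inl he))]

/-- The inner hybrid of the pair swapped along `S₁` agrees with `ω` on the edges at the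
`a`-cluster. -/
theorem hybridC_inner_agree (ω ω' : Config E) (a b c : V) :
    ∀ e ∈ G.edgesAt (G.cluster ω a),
      ω e = mix (G.edgesAt (G.cluster (mix (G.swapSetC ω a b c) ω ω') c))
        (mix (G.swapSetC ω a b c) ω ω') (mix (G.swapSetC ω a b c)ᶜ ω ω') e := by
  intro e he
  rw [cluster_mix_swapSetC]
  by_cases hC : e ∈ G.edgesAt (G.cluster ω c)
  · rw [mix_apply_of_mem hC, mix_apply_of_mem (G.mem_swapSetC.mpr (Or.inl hC))]
  · rw [mix_apply_of_notMem hC, mix_compl_apply_of_notMem]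
    intro hmem
    rcases G.mem_swapSetC.mp hmem with h | h
    · exact hC h
    · exact h.2 he

/-- The hybrid of the pair swapped along `S₁` agrees with `ω` on every edge at the clusters of
`a`, `b`, `c`. -/
theorem hybridC_agree (ω ω' : Config E) (a b c : V) :
    ∀ e ∈ G.edgesAt (G.cluster ω a ∪ G.cluster ω b ∪ G.cluster ω c),
      ω e = G.hybridC a c (mix (G.swapSetC ω a b c)ᶜ ω ω') (mix (G.swapSetC ω a b c) ω ω') e := by
  intro e he
  have hinner := cluster_eq_of_agree (hybridC_inner_agree (G := G) ω ω' a b c)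
  simp only [hybridC]
  rw [hinner, cluster_mix_swapSetC]
  by_cases hC : e ∈ G.edgesAt (G.cluster ω c)
  · rw [mix_apply_of_mem hC, mix_apply_of_mem (G.mem_swapSetC.mpr (Or.inl hC))]
  · rw [mix_apply_of_notMem hC]
    by_cases hA : e ∈ G.edgesAt (G.cluster ω a)
    · rw [mix_apply_of_mem hA, mix_compl_apply_of_notMem]
      intro hmem
      rcases G.mem_swapSetC.mp hmem with h | h
      · exact hC h
      · exact h.2 hA
    · rw [mix_apply_of_notMem hA, mix_apply_of_mem]
      rw [mem_edgesAt_union_iff, mem_edgesAt_union_iff] at he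
      refine G.mem_swapSetC.mpr (Or.inr ⟨?_, hA⟩)
      rcases he with (h | h) | h
      · exact absurd h hA
      · exact h
      · exact absurd h hC

/-- `S₁` is recoverable from the swapped pair. -/
theorem recoverable_swapSetC (a b c : V) : Recoverable (fun ω _ => G.swapSetC ω a b c) := by
  refine ⟨fun φ₁ φ₂ => G.swapSetC (G.hybridC a c φ₁ φ₂) a b c, fun ω ω' => ?_⟩
  have h := hybridC_agree (G := G) ω ω' a b c
  have ha := cluster_eq_of_agree_of_subset (Set.subset_union_left.trans Set.subset_union_left) h
  have hb := cluster_eq_of_agree_of_subset (Set.subset_union_right.trans Set.subset_union_left) h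
  have hc := cluster_eq_of_agree_of_subset Set.subset_union_right h
  show G.swapSetC (G.hybridC a c (mix (G.swapSetC ω a b c)ᶜ ω ω') (mix (G.swapSetC ω a b c) ω ω'))
      a b c = G.swapSetC ω a b c
  generalize G.hybridC a c (mix (G.swapSetC ω a b c)ᶜ ω ω') (mix (G.swapSetC ω a b c) ω ω') = H
    at ha hb hc ⊢
  simp only [swapSetC, ha, hb, hc]

end SwapSets

end MultiGraph

end PercRepro
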